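import Mathlib
import Summits.ValiantsHypothesis.ValiantsHypothesis.Theorems.ValuativeGCTValuativeFlipRayStability
import HarnessLib

/-!
# `ValuativeGCT.ValuativeFlip` (stmt-ValiantsHypothesis-12624): ray stability, II — the permanent
# side, from the eventual padding transfer

Wall-breaker k16 (axis "representation-stability transfer between `m` and `m + 1`"), companion of
`…RayStability`.  Letters as there: `n ≥ 1`, `δ`, `μ ⊢ n·δ` with at most `n²` parts,
`P(j) = mult_{(μ♯(n+j))*} ℂ[Δ_{n+j}(X₀₀^j per_n)]`, `K(j) = K_{n+j}((μ♯(n+j))*)`, stable value `K∞(μ)`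
(`det_rayStable`).

The per-side analogue of `det_eventualMonotone` from EVERY start of the ray is the eventual padding
transfer of wall-breaker k4 (registered stub `eventualPaddingTransfer` of this crux:
`mult_{λ*} ℂ[Δ_m(X₀₀^{m-n} per_n)] ≤ mult_{(λ♯(m+j))*} ℂ[Δ_{m+j}(X₀₀^{m+j-n} per_n)]` for all
`j ≥ j₀(n, m, λ)`; its proof — certificates with a prescribed column, `…PaddingTransferPoints`, and the
twist polynomial — is k4's).  Taking that statement as a HYPOTHESIS `hEPT` (it is discharged by k4's
theorem the moment it lands; nothing here depends on its proof), this file derives: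

* `per_ray_eventually_ge_of_eventualPaddingTransfer` — `P(j₁) ≤ P(j)` for all `j ≥ J(j₁)`;
* `per_rayStable_of_eventualPaddingTransfer` — **`P(j)` is eventually constant `=: P∞(μ)`**, the
  maximum over the ray (boundedness is unconditional: `P(j) ≤ K∞(μ)` for large `j`,
  `per_ray_le_det_rayLimit`);
* `per_rayLimit_le_det_rayLimit_of_eventualPaddingTransfer` — **`P_n(μ) ≤ P∞(μ) ≤ K∞(μ) ≤ g∞(μ)`**:
  both sides of the flip inequality stabilise along every Kadish–Landsberg ray and the stable values
  are ordered the wrong way for a flip; with `…RayStability` this is the complete stable picture of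
  the `m → m + 1` axis (flips live in the transient only).

[BLMW 2011 §6.4 Problem 6.10; Ikenmeyer–Panova 2017 §2; this crux's `eventualPaddingTransfer` (k4),
`…RayStability` (k16)]
-/

set_option linter.dupNamespace false

namespace Summit.ValiantsHypothesis.ValiantsHypothesis.Theorems.ValuativeFlip

open Literature.NumberTheory.DiophantineGeometry
open Literature.Computability.AlgebraicComplexity
open Literature.Computability.Complexity

noncomputable section

/-- **Eventual domination from every start of the permanent's ray**, from the eventual padding
transfer `hEPT` (k4's registered `eventualPaddingTransfer`, taken as a hypothesis): for every `j₁`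
there is `J` with `P(j₁) ≤ P(j)` for all `j ≥ J` (apply `hEPT` at level `n + j₁` to `μ♯(n+j₁)` and
compose row lifts, `parts_rowLift_rowLift`). [BLMW 2011 Problem 6.10 (eventual); this crux, k4] -/
theorem per_ray_eventually_ge_of_eventualPaddingTransfer
    (hEPT : ∀ (n m δ : ℕ) [NeZero m], n ≤ m → ∀ (lam : Nat.Partition (m * δ)), lam.parts.card ≤ m * m →
      ∃ j₀, ∀ j ≥ j₀, ∀ [NeZero (m + j)],
        orbitMultiplicity ℂ (paddedPerFormLex ℂ n m) m (partitionWeightLex m lam) ≤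
          orbitMultiplicity ℂ (paddedPerFormLex ℂ n (m + j)) (m + j) (partitionWeightLex (m + j) (rowLift lam j)))
    (n δ : ℕ) [NeZero n] (μ : Nat.Partition (n * δ)) (hμ : μ.parts.card ≤ n * n) (j₁ : ℕ) :
    ∃ J : ℕ, ∀ j : ℕ, J ≤ j → ∀ [NeZero (n + j₁)] [NeZero (n + j)],
      orbitMultiplicity ℂ (paddedPerFormLex ℂ n (n + j₁)) (n + j₁) (partitionWeightLex (n + j₁) (rowLift μ j₁)) ≤
        orbitMultiplicity ℂ (paddedPerFormLex ℂ n (n + j)) (n + j) (partitionWeightLex (n + j) (rowLift μ j)) := by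
  haveI : NeZero (n + j₁) := ⟨by have := NeZero.ne n; omega⟩
  obtain ⟨j₀, hj₀⟩ := hEPT n (n + j₁) δ (Nat.le_add_right n j₁) (rowLift μ j₁) (card_parts_rowLift_le_sq μ hμ j₁)
  refine ⟨j₁ + j₀, fun j hj _ _ => ?_⟩
  obtain ⟨j', rfl⟩ : ∃ j', j = j₁ + j' := ⟨j - j₁, by omega⟩
  haveI : NeZero (n + j₁ + j') := ⟨by have := NeZero.ne n; omega⟩
  have h := hj₀ j' (by omega)
  rwa [orbitMultiplicity_paddedPer_congr_level (show n + j₁ + j' = n + (j₁ + j') by ring)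
    (rowLift (rowLift μ j₁) j') (rowLift μ (j₁ + j')) (parts_rowLift_rowLift μ j₁ j')] at h

/-- **RAY STABILITY OF THE PADDED PERMANENT (from the eventual padding transfer).**  Under `hEPT`,
for every `n ≥ 1`, `δ`, `μ ⊢ n·δ` with at most `n²` parts, `P(j) = mult_{(μ♯(n+j))*} ℂ[Δ_{n+j}(X₀₀^j per_n)]`
is EVENTUALLY CONSTANT `=: P∞(μ)` in the padding `j`, and `P(j) ≤ P∞(μ)` for every `j` (so
`P∞(μ) = max_j P(j) ≥ P_n(μ)`).  Boundedness is unconditional (`per_ray_le_det_rayLimit`: `P(j) ≤ K∞(μ)`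
for large `j`); eventual domination from every start is `hEPT`.
[BLMW 2011 §6.4; this crux, k4 (`eventualPaddingTransfer`) and k16 (`det_rayStable`)] -/
theorem per_rayStable_of_eventualPaddingTransfer
    (hEPT : ∀ (n m δ : ℕ) [NeZero m], n ≤ m → ∀ (lam : Nat.Partition (m * δ)), lam.parts.card ≤ m * m →
      ∃ j₀, ∀ j ≥ j₀, ∀ [NeZero (m + j)],
        orbitMultiplicity ℂ (paddedPerFormLex ℂ n m) m (partitionWeightLex m lam) ≤
          orbitMultiplicity ℂ (paddedPerFormLex ℂ n (m + j)) (m + j) (partitionWeightLex (m + j) (rowLift lam j)))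
    (n δ : ℕ) [NeZero n] (μ : Nat.Partition (n * δ)) (hμ : μ.parts.card ≤ n * n) :
    ∃ j₀ P : ℕ,
      (∀ j : ℕ, j₀ ≤ j → ∀ [NeZero (n + j)],
        orbitMultiplicity ℂ (paddedPerFormLex ℂ n (n + j)) (n + j) (partitionWeightLex (n + j) (rowLift μ j)) = P) ∧
      (∀ (j : ℕ) [NeZero (n + j)],
        orbitMultiplicity ℂ (paddedPerFormLex ℂ n (n + j)) (n + j) (partitionWeightLex (n + j) (rowLift μ j)) ≤ P) := by
  -- the ray as a plain function (the `NeZero` instance is a proposition, so any two agree)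
  let f : ℕ → ℕ := fun j =>
    haveI : NeZero (n + j) := ⟨by have := NeZero.ne n; omega⟩
    orbitMultiplicity ℂ (paddedPerFormLex ℂ n (n + j)) (n + j) (partitionWeightLex (n + j) (rowLift μ j))
  have hf : ∀ (j : ℕ) [NeZero (n + j)],
      orbitMultiplicity ℂ (paddedPerFormLex ℂ n (n + j)) (n + j) (partitionWeightLex (n + j) (rowLift μ j)) = f j :=
    fun j _ => rfl
  have hdom : ∀ j₁ : ℕ, ∃ J : ℕ, ∀ j : ℕ, J ≤ j → f j₁ ≤ f j := by
    intro j₁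
    obtain ⟨J, hJ⟩ := per_ray_eventually_ge_of_eventualPaddingTransfer hEPT n δ μ hμ j₁
    refine ⟨J, fun j hj => ?_⟩
    haveI : NeZero (n + j₁) := ⟨by have := NeZero.ne n; omega⟩
    haveI : NeZero (n + j) := ⟨by have := NeZero.ne n; omega⟩
    rw [← hf j₁, ← hf j]
    exact hJ j hj
  have hbdd : ∃ B J : ℕ, ∀ j : ℕ, J ≤ j → f j ≤ B := by
    obtain ⟨j₀, K, hK, -⟩ := det_rayStable n δ μ hμ
    obtain ⟨j₂, hj₂⟩ := per_ray_le_det_rayLimit n δ μ ⟨j₀, hK⟩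
    refine ⟨K, j₂, fun j hj => ?_⟩
    haveI : NeZero (n + j) := ⟨by have := NeZero.ne n; omega⟩
    rw [← hf j]
    exact hj₂ j hj
  obtain ⟨j₀, P, hconst, hle⟩ := nat_eventuallyConst_of_eventually_le_of_bdd f hdom hbdd
  exact ⟨j₀, P, fun j hj _ => (hf j).trans (hconst j hj), fun j _ => (hf j).trans_le (hle j)⟩

/-- **THE STABLE VALUES ARE ORDERED AGAINST A FLIP: `P_n(μ) ≤ P∞(μ) ≤ K∞(μ)`** (under `hEPT`).  For
any eventual value `P∞` of the permanent's ray and any eventual value `K∞` of the determinant's ray: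
the permanent's own multiplicity `P_n(μ)` is at most `P∞` (case `j = 0` of
`per_rayStable_of_eventualPaddingTransfer`), and `P∞ ≤ K∞` (both rays have stabilised at a common
large `j`, where `per_ray_le_det_rayLimit` applies).  With `det_rayLimit_le_kronecker_rayLimit`:
`P_n(μ) ≤ P∞(μ) ≤ K∞(μ) ≤ g∞(μ)`. [this crux, k4 + k16] -/
theorem per_rayLimit_le_det_rayLimit_of_eventualPaddingTransfer
    (hEPT : ∀ (n m δ : ℕ) [NeZero m], n ≤ m → ∀ (lam : Nat.Partition (m * δ)), lam.parts.card ≤ m * m →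
      ∃ j₀, ∀ j ≥ j₀, ∀ [NeZero (m + j)],
        orbitMultiplicity ℂ (paddedPerFormLex ℂ n m) m (partitionWeightLex m lam) ≤
          orbitMultiplicity ℂ (paddedPerFormLex ℂ n (m + j)) (m + j) (partitionWeightLex (m + j) (rowLift lam j)))
    (n δ : ℕ) [NeZero n] (μ : Nat.Partition (n * δ)) (hμ : μ.parts.card ≤ n * n) {P K : ℕ}
    (hP : ∃ j₀ : ℕ, ∀ j : ℕ, j₀ ≤ j → ∀ [NeZero (n + j)],
      orbitMultiplicity ℂ (paddedPerFormLex ℂ n (n + j)) (n + j) (partitionWeightLex (n + j) (rowLift μ j)) = P)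
    (hK : ∃ j₀ : ℕ, ∀ j : ℕ, j₀ ≤ j →
      orbitMultiplicity ℂ (detFormLex ℂ (n + j)) (n + j) (partitionWeightLex (n + j) (rowLift μ j)) = K) :
    orbitMultiplicity ℂ (paddedPerFormLex ℂ n n) n (partitionWeightLex n μ) ≤ P ∧ P ≤ K := by
  obtain ⟨j₀, hj₀⟩ := hP
  obtain ⟨j₁, P₁, hP₁, hle₁⟩ := per_rayStable_of_eventualPaddingTransfer hEPT n δ μ hμ
  -- the two eventual values of the permanent's ray agree
  have hPP : P₁ = P := by
    haveI : NeZero (n + max j₀ j₁) := ⟨by have := NeZero.ne n; omega⟩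
    rw [← hP₁ (max j₀ j₁) (le_max_right _ _), ← hj₀ (max j₀ j₁) (le_max_left _ _)]
  obtain ⟨j₂, hj₂⟩ := per_ray_le_det_rayLimit n δ μ hK
  refine ⟨?_, ?_⟩
  · -- `P_n(μ) = P(0) ≤ P₁ = P`
    haveI : NeZero (n + 0) := ⟨by have := NeZero.ne n; omega⟩
    have h0 := hle₁ 0
    rw [hPP, ← orbitMultiplicity_paddedPer_congr_level (show n = n + 0 by ring) μ (rowLift μ 0)
      (parts_rowLift_zero μ).symm] at h0
    exact h0
  · haveI : NeZero (n + max j₀ j₂) := ⟨by have := NeZero.ne n; omega⟩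
    rw [← hj₀ (max j₀ j₂) (le_max_left _ _)]
    exact hj₂ (max j₀ j₂) (le_max_right _ _)


/-! ## Appendix (same seat): a flip certifies a pre-stable determinant ray -/

/-- **A FLIP ON THE RAY OF `μ` CERTIFIES THAT `Δ(det)` HAS NOT YET STABILISED THERE** (under `hEPT`).
If at padding `j` the permanent side exceeds the determinant side for the row-lifted shape,
`K_{n+j}((μ♯)*) < mult_{(μ♯)*} ℂ[Δ_{n+j}(X₀₀^j per_n)]`, then `K_{n+j}((μ♯)*) < K∞(μ)` STRICTLY, for any
eventual value `K∞(μ)` of the determinant's ray: indeed `P(j) ≤ P∞(μ) ≤ K∞(μ)` for EVERY `j`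
(`per_rayStable_of_eventualPaddingTransfer`, `per_rayLimit_le_det_rayLimit_of_eventualPaddingTransfer`).
So a multiplicity flip in the `K`-currency at a position of the ray is only possible while the
determinant's orbit-closure multiplicity is still strictly below its stable value: flips live in the
transient of the DETERMINANT's ray, not merely before a common stabilisation threshold.
[this crux, k4 (`eventualPaddingTransfer`) + k16] -/
theorem det_lt_rayLimit_of_flip_of_eventualPaddingTransfer
    (hEPT : ∀ (n m δ : ℕ) [NeZero m], n ≤ m → ∀ (lam : Nat.Partition (m * δ)), lam.parts.card ≤ m * m →
      ∃ j₀, ∀ j ≥ j₀, ∀ [NeZero (m + j)],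
        orbitMultiplicity ℂ (paddedPerFormLex ℂ n m) m (partitionWeightLex m lam) ≤
          orbitMultiplicity ℂ (paddedPerFormLex ℂ n (m + j)) (m + j) (partitionWeightLex (m + j) (rowLift lam j)))
    (n δ : ℕ) [NeZero n] (μ : Nat.Partition (n * δ)) (hμ : μ.parts.card ≤ n * n) {K : ℕ}
    (hK : ∃ j₀ : ℕ, ∀ j : ℕ, j₀ ≤ j →
      orbitMultiplicity ℂ (detFormLex ℂ (n + j)) (n + j) (partitionWeightLex (n + j) (rowLift μ j)) = K)
    (j : ℕ) [NeZero (n + j)]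
    (hflip : orbitMultiplicity ℂ (detFormLex ℂ (n + j)) (n + j) (partitionWeightLex (n + j) (rowLift μ j)) <
      orbitMultiplicity ℂ (paddedPerFormLex ℂ n (n + j)) (n + j) (partitionWeightLex (n + j) (rowLift μ j))) :
    orbitMultiplicity ℂ (detFormLex ℂ (n + j)) (n + j) (partitionWeightLex (n + j) (rowLift μ j)) < K := by
  obtain ⟨j₁, P, hP, hPle⟩ := per_rayStable_of_eventualPaddingTransfer hEPT n δ μ hμ
  have hPK := (per_rayLimit_le_det_rayLimit_of_eventualPaddingTransfer hEPT n δ μ hμ ⟨j₁, hP⟩ hK).2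
  exact hflip.trans_le ((hPle j).trans hPK)

/-- **The same at every smaller inner size**: a flip `K_{n+j}((μ♯)*) < mult_{(μ♯)*} ℂ[Δ_{n+j}(X₀₀^{n+j-n'} per_{n'})]`
with `n' ≤ n` also forces `K_{n+j}((μ♯)*) < K∞(μ)` (inner monotonicity
`orbitMultiplicity_paddedPer_mono_inner`: the padded `per_{n'}` is a degeneration of the padded `per_n`).
[this crux's `…InnerMonotone`; this file] -/
theorem det_lt_rayLimit_of_flip_inner_of_eventualPaddingTransfer
    (hEPT : ∀ (n m δ : ℕ) [NeZero m], n ≤ m → ∀ (lam : Nat.Partition (m * δ)), lam.parts.card ≤ m * m →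
      ∃ j₀, ∀ j ≥ j₀, ∀ [NeZero (m + j)],
        orbitMultiplicity ℂ (paddedPerFormLex ℂ n m) m (partitionWeightLex m lam) ≤
          orbitMultiplicity ℂ (paddedPerFormLex ℂ n (m + j)) (m + j) (partitionWeightLex (m + j) (rowLift lam j)))
    (n δ : ℕ) [NeZero n] (μ : Nat.Partition (n * δ)) (hμ : μ.parts.card ≤ n * n) {K : ℕ}
    (hK : ∃ j₀ : ℕ, ∀ j : ℕ, j₀ ≤ j →
      orbitMultiplicity ℂ (detFormLex ℂ (n + j)) (n + j) (partitionWeightLex (n + j) (rowLift μ j)) = K)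
    (j : ℕ) [NeZero (n + j)] {n' : ℕ} (hn' : n' ≤ n)
    (hflip : orbitMultiplicity ℂ (detFormLex ℂ (n + j)) (n + j) (partitionWeightLex (n + j) (rowLift μ j)) <
      orbitMultiplicity ℂ (paddedPerFormLex ℂ n' (n + j)) (n + j) (partitionWeightLex (n + j) (rowLift μ j))) :
    orbitMultiplicity ℂ (detFormLex ℂ (n + j)) (n + j) (partitionWeightLex (n + j) (rowLift μ j)) < K :=
  det_lt_rayLimit_of_flip_of_eventualPaddingTransfer hEPT n δ μ hμ hK j
    (hflip.trans_le (orbitMultiplicity_paddedPer_mono_inner hn' (Nat.le_add_right n j) _))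

end

end Summit.ValiantsHypothesis.ValiantsHypothesis.Theorems.ValuativeFlip
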